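import Summits.NavierStokesRegularity.NavierStokesRegularity.Theses.QuantisedSymmetry
import Summits.NavierStokesRegularity.NavierStokesRegularity.Theses.Blowup
import Summits.NavierStokesRegularity.NavierStokesRegularity.Theorems.QuantisedSymmetryPolyhedralTruncationBridge
import Summits.NavierStokesRegularity.NavierStokesRegularity.Theorems.QuantisedSymmetryLiouvilleKillsProfile
import Summits.NavierStokesRegularity.NavierStokesRegularity.Theorems.QuantisedSymmetryPolyhedralDssProfileExistsDominatesBlowupProfile
import Literature.Analysis.FluidPDE.SelfSimilarLiouville
import HarnessLib

/-!
# Strategist companion (family `s`, gen 3) to `STRATEGY-CENSUS-s22.md` — crux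
# `QuantisedSymmetry.PolyhedralDssProfileExists` (stmt-NavierStokesRegularity-1404)

Typed record of the census attempts (no `sorry`; every `theorem` here is kernel-checked glue
between EXISTING decls, every `def` is a candidate intermediate / piece / strengthening named
in the census).  Nothing here is a route item; this file is evidence only.

* §1 Summit-down: the crux already decides `¬ NavierStokesRegularity` unconditionally
  (`crux_decides_summit`), through the chain X⁻ → W1 (`Blowup.BlowupTypeIDssProfile`) and
  X⁻ → W3 (`Blowup.BlowupExists`) → ¬S; every strictly-weaker intermediate on the chain is a
  crux of route `Blowup` (merge, not a strategy).
* §2 Decomposition Σ_sel = (A : a nontrivial polyhedral bounded ancient Type-I solution exists)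
  ∧ (B : A → X⁻, "DSS selection"); assembly `crux_of_selection` proved; `crux_gives_A` proved
  (so A is a CONSEQUENCE of X⁻, strictly on the X⁻ side of the kill switch #3).
* §3 Strengthenings S⁺ that land in proved-empty classes are recorded as defs with the
  emptiness witnesses named in the census (not restated here).
-/

set_option linter.dupNamespace false
set_option autoImplicit false

namespace Summit.NavierStokesRegularity.NavierStokesRegularity.Cruxes.PolyhedralDssProfileExists.CensusS22g3

open MeasureTheory
open Literature.Analysis.FluidPDE
open _root_.Summit.NavierStokesRegularity.NavierStokesRegularity.Theses

/-- shorthand -/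
abbrev E3 := EuclideanSpace ℝ (Fin 3)

/-- The group clauses of the crux: finite, proper rotations, irreducible on ℝ³ (T/O/I classes). -/
def IsPolyhedralGroup (G : Subgroup (E3 ≃ₗᵢ[ℝ] E3)) : Prop :=
  Finite G ∧ (∀ g ∈ G, LinearMap.det (g.toLinearEquiv : E3 →ₗ[ℝ] E3) = 1) ∧
    (∀ V : Submodule ℝ E3, (∀ g ∈ G, ∀ v ∈ V, g v ∈ V) → V = ⊥ ∨ V = ⊤)

/-! ## §1 Summit-down -/

/-- The crux decides the summit negatively with NO open co-hypothesis: both other binders of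
`QuantisedSymmetry.closes` are tree theorems. -/
theorem crux_decides_summit :
    QuantisedSymmetry.PolyhedralDssProfileExists → ¬ _root_.NavierStokesRegularity :=
  fun hX => QuantisedSymmetry.closes hX
    _root_.Summit.NavierStokesRegularity.NavierStokesRegularity.Theorems.quantisedSymmetry_polyhedralTruncationBridge_proof
    QuantisedSymmetry.ClayUniqueness_holds

/-- W1: X⁻ ⇒ the sector-agnostic profile crux of route `Blowup` (stmt-0155). Tree theorem. -/
theorem crux_gives_W1 :
    QuantisedSymmetry.PolyhedralDssProfileExists → Blowup.BlowupTypeIDssProfile :=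
  _root_.Summit.NavierStokesRegularity.NavierStokesRegularity.Theorems.PolyhedralDssProfileExists.PolyhedralCell.stub_dominatesBlowupProfile

/-- W3: X⁻ ⇒ `Blowup.BlowupExists` (stmt-0152, ≡ ¬NoBlowup), by the proved truncation bridge. -/
theorem crux_gives_W3 :
    QuantisedSymmetry.PolyhedralDssProfileExists → Blowup.BlowupExists := by
  rintro ⟨G, hfin, hdet, hirr, c, hc, w, hanc, hmeas, hdss, hdec, heqv, hnt⟩
  exact _root_.Summit.NavierStokesRegularity.NavierStokesRegularity.Theorems.quantisedSymmetry_polyhedralTruncationBridge_proof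
    G hfin hdet hirr c hc w hanc hmeas hdss hdec heqv hnt

/-- W3 decides the summit (route `Blowup`'s `closes` with its proved uniqueness binder). -/
theorem W3_decides_summit : Blowup.BlowupExists → ¬ _root_.NavierStokesRegularity :=
  fun h => Blowup.closes h Blowup.BlowupClayUniqueness_holds


/-- W1 ⇒ W3 in the tree: the sector-agnostic profile crux already yields blow-up, by the proved
ROTATED truncation bridge `FilamentSkeletonRss.RdssProfileTruncation`
(`filamentSkeletonRss_rdssProfileTruncation_proof`); so W1 decides the summit exactly as X⁻ does,
and the G-clauses of X⁻ are load-bearing nowhere between X⁻ and ¬S. -/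
theorem W1_gives_W3 : Blowup.BlowupTypeIDssProfile → Blowup.BlowupExists := by
  intro h
  by_contra hne
  apply h
  intro c
  refine ⟨?_, fun R => ?_⟩
  · intro hc u hanc hmeas hdss hdec
    by_contra hnt
    exact hne (_root_.Summit.NavierStokesRegularity.NavierStokesRegularity.Theorems.filamentSkeletonRss_rdssProfileTruncation_proof
      ⟨c, LinearIsometryEquiv.refl ℝ _, u, hc, hanc, hmeas, isRotatedDSS_refl_iff.mpr hdss, hdec, hnt⟩)
  · intro hc u hanc hmeas hrdss hdec
    by_contra hnt
    exact hne (_root_.Summit.NavierStokesRegularity.NavierStokesRegularity.Theorems.filamentSkeletonRss_rdssProfileTruncation_proof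
      ⟨c, R, u, hc, hanc, hmeas, hrdss, hdec, hnt⟩)

/-- Hence W1 decides the summit (the weaker intermediate is itself summit-deciding). -/
theorem W1_decides_summit : Blowup.BlowupTypeIDssProfile → ¬ _root_.NavierStokesRegularity :=
  fun h => W3_decides_summit (W1_gives_W3 h)

/-! ## §2 Decomposition Σ_sel -/

/-- Piece A: a nontrivial polyhedrally-equivariant BOUNDED ancient mild Type-I solution exists
(no self-similarity).  Literally `¬ QuantisedSymmetry.PolyhedralTypeILiouville` (route item #3). -/
def PolyhedralTypeIAncientExists : Prop := ¬ QuantisedSymmetry.PolyhedralTypeILiouville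

/-- Piece B ("DSS selection"): from some nontrivial polyhedral bounded ancient Type-I solution,
produce a DISCRETELY SELF-SIMILAR one.  No mechanism known (census §Decomposition). -/
def DssSelection : Prop :=
  PolyhedralTypeIAncientExists → QuantisedSymmetry.PolyhedralDssProfileExists

/-- Assembly of Σ_sel (modus ponens; triviality of the seam is irrelevant, rule (b)). -/
theorem crux_of_selection :
    PolyhedralTypeIAncientExists → DssSelection → QuantisedSymmetry.PolyhedralDssProfileExists :=
  fun hA hB => hB hA

/-- A is a consequence of X⁻ (contrapositive of the proved kill switch `LiouvilleKillsProfile`,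
stmt-1408): so A is genuinely WEAKER-or-equal, and B carries all of the self-similar content. -/
theorem crux_gives_A :
    QuantisedSymmetry.PolyhedralDssProfileExists → PolyhedralTypeIAncientExists :=
  fun hX hL =>
    _root_.Summit.NavierStokesRegularity.NavierStokesRegularity.Theorems.quantisedSymmetry_liouvilleKillsProfile_proof
      hL hX

/-! ## §3 Strengthenings recorded in the census (statements only) -/

/-- S⁺1: a λ-CONTINUOUSLY self-similar polyhedral Type-I profile (empty: Tsai 1998 / NRŠ 1996,
tree `tsai_selfsimilar_holds`-type facts; census §Strengthen). -/
def PolyhedralSelfSimilarProfileExists : Prop :=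
  ∃ G : Subgroup (E3 ≃ₗᵢ[ℝ] E3), IsPolyhedralGroup G ∧
    ∃ u : ℝ → E3 → E3, IsAncientMildSolution 1 u ∧ (∀ t < 0, AEStronglyMeasurable (u t) volume) ∧
      IsSelfSimilar u ∧ (∃ C₀ : ℝ, HasTypeIDecay C₀ u) ∧
        (∀ g ∈ G, ∀ t x, u t (g x) = g (u t x)) ∧ ¬ (∀ t < 0, u t =ᵐ[volume] 0)

/-- S⁺1 ⇒ X⁻ at every factor (a self-similar field is λ-DSS for every λ > 0). -/
theorem crux_of_selfSimilar (c : ℝ) (hc : 1 < c) :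
    PolyhedralSelfSimilarProfileExists → QuantisedSymmetry.PolyhedralDssProfileExists := by
  rintro ⟨G, ⟨hfin, hdet, hirr⟩, u, hanc, hmeas, hss, hdec, heqv, hnt⟩
  exact ⟨G, hfin, hdet, hirr, c, hc, u, hanc, hmeas, hss.isDiscretelySelfSimilar (by linarith),
    hdec, heqv, hnt⟩

/-- S⁺5: the profile with an `L³` slice (empty by ESS 2003 backward uniqueness; census). -/
def PolyhedralDssProfileWithL3Slice : Prop :=
  ∃ G : Subgroup (E3 ≃ₗᵢ[ℝ] E3), IsPolyhedralGroup G ∧ ∃ c : ℝ, 1 < c ∧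
    ∃ u : ℝ → E3 → E3, IsAncientMildSolution 1 u ∧ (∀ t < 0, AEStronglyMeasurable (u t) volume) ∧
      IsDiscretelySelfSimilar c u ∧ (∃ C₀ : ℝ, HasTypeIDecay C₀ u) ∧
        (∀ g ∈ G, ∀ t x, u t (g x) = g (u t x)) ∧ (∃ t < 0, MemLp (u t) 3 volume) ∧
          ¬ (∀ t < 0, u t =ᵐ[volume] 0)

/-- S⁺5 ⇒ X⁻ (drop the slice). -/
theorem crux_of_L3Slice :
    PolyhedralDssProfileWithL3Slice → QuantisedSymmetry.PolyhedralDssProfileExists := by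
  rintro ⟨G, ⟨hfin, hdet, hirr⟩, c, hc, u, hanc, hmeas, hdss, hdec, heqv, -, hnt⟩
  exact ⟨G, hfin, hdet, hirr, c, hc, u, hanc, hmeas, hdss, hdec, heqv, hnt⟩

end Summit.NavierStokesRegularity.NavierStokesRegularity.Cruxes.PolyhedralDssProfileExists.CensusS22g3
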